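import Mathlib

/-!
# Grid-to-continuum sup bounds (validated numerics, Bernstein-type self-improvement)

The one analytic step of a *sup-norm certificate by sampling*: a function `f : ℝ → ℝ` whose
derivative is controlled by its own sup norm (`|f'| ≤ n · ‖f‖_∞`, e.g. Bernstein's inequality
for a trigonometric polynomial of degree `n`, see Nevai–Totik / any text; the inequality is quoted,
not proved, here — it enters as the hypothesis `hB`) is bounded on the whole line by its maximum over
a grid of mesh `δ` (every point within `δ` of a node) times `1/(1 − n δ)` provided `n δ < 1`.

Nothing here is specific to trigonometric polynomials: the lemma isolates exactly the hypothesis a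
certificate must supply. A two-variable version (`abs_le_of_grid₂`) applies the one-variable
statement in each variable, which is how a certificate over a product grid uses it.

Sources for the Bernstein hypothesis in the trigonometric case: `sup|T'| ≤ n sup|T|` for a real
trigonometric polynomial of degree `n` — S. N. Bernstein (1912); stated e.g. as inequality (1.1) of
arXiv:1903.10801, p. 3.
-/

namespace Literature.Analysis.ValidatedNumerics

open Set

/-- Mean-value step: if `|f'| ≤ B` everywhere and every point is within `δ` of a grid node on which
`|f| ≤ m`, then `|f| ≤ m + B δ` everywhere. [folklore] -/
theorem abs_le_grid_add {f : ℝ → ℝ} (hf : Differentiable ℝ f) {B : ℝ}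
    (hB : ∀ x, ‖deriv f x‖ ≤ B) {G : Set ℝ} {δ m : ℝ}
    (hG : ∀ x, ∃ g ∈ G, |x - g| ≤ δ) (hm : ∀ g ∈ G, |f g| ≤ m) (x : ℝ) :
    |f x| ≤ m + B * δ := by
  obtain ⟨g, hg, hxg⟩ := hG x
  have hlip : ‖f x - f g‖ ≤ B * ‖x - g‖ :=
    Convex.norm_image_sub_le_of_norm_deriv_le (fun y _ => hf y) (fun y _ => hB y)
      convex_univ (mem_univ g) (mem_univ x)
  have hB0 : 0 ≤ B := le_trans (norm_nonneg _) (hB 0)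
  calc |f x| = |f g + (f x - f g)| := by ring_nf
    _ ≤ |f g| + |f x - f g| := abs_add_le _ _
    _ ≤ m + B * δ := by
      gcongr
      · exact hm g hg
      · calc |f x - f g| = ‖f x - f g‖ := rfl
          _ ≤ B * ‖x - g‖ := hlip
          _ ≤ B * δ := by
            gcongr
            simpa [Real.norm_eq_abs] using hxg

/-- Bernstein-type self-improvement: if `|f'| ≤ n · S` where `S = sup |f|`, `f` is bounded, and
`n δ < 1`, then `sup |f| ≤ (max over the grid) / (1 − n δ)`. [folklore] -/
theorem abs_le_grid_div {f : ℝ → ℝ} (hf : Differentiable ℝ f)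
    (hbdd : BddAbove (range fun x => |f x|)) {n δ m : ℝ} (hnδ : n * δ < 1)
    (hB : ∀ x, ‖deriv f x‖ ≤ n * sSup (range fun x => |f x|))
    {G : Set ℝ} (hG : ∀ x, ∃ g ∈ G, |x - g| ≤ δ) (hm : ∀ g ∈ G, |f g| ≤ m) (x : ℝ) :
    |f x| ≤ m / (1 - n * δ) := by
  set S := sSup (range fun x => |f x|) with hS
  have hpt : ∀ y, |f y| ≤ m + (n * S) * δ := fun y => abs_le_grid_add hf hB hG hm y
  have hSle : S ≤ m + (n * S) * δ :=
    csSup_le (range_nonempty _) (by rintro _ ⟨y, rfl⟩; exact hpt y)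
  have hxS : |f x| ≤ S := le_csSup hbdd ⟨x, rfl⟩
  have hpos : 0 < 1 - n * δ := by linarith
  rw [le_div_iff₀ hpos]
  nlinarith [hxS, hSle]

/-- Two-variable version over a product grid `G₁ × G₂`: the one-variable bound is applied in the
second variable at each node of `G₁`, then in the first variable at each fixed second argument.
Hypotheses: for every `t`, `f (·, t)` is differentiable, bounded, and satisfies the Bernstein
hypothesis with constant `n₁`; for every node `g₁ ∈ G₁`, `f (g₁, ·)` likewise with `n₂`. [folklore] -/
theorem abs_le_grid_div₂ {f : ℝ → ℝ → ℝ} {n₁ n₂ δ₁ δ₂ m : ℝ}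
    (h₁ : n₁ * δ₁ < 1) (h₂ : n₂ * δ₂ < 1)
    {G₁ G₂ : Set ℝ}
    (hG₁ : ∀ x, ∃ g ∈ G₁, |x - g| ≤ δ₁) (hG₂ : ∀ y, ∃ g ∈ G₂, |y - g| ≤ δ₂)
    (hf₁ : ∀ t, Differentiable ℝ (fun s => f s t))
    (hbdd₁ : ∀ t, BddAbove (range fun s => |f s t|))
    (hB₁ : ∀ t s, ‖deriv (fun s => f s t) s‖ ≤ n₁ * sSup (range fun s => |f s t|))
    (hf₂ : ∀ g ∈ G₁, Differentiable ℝ (fun t => f g t))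
    (hbdd₂ : ∀ g ∈ G₁, BddAbove (range fun t => |f g t|))
    (hB₂ : ∀ g ∈ G₁, ∀ t, ‖deriv (fun t => f g t) t‖ ≤ n₂ * sSup (range fun t => |f g t|))
    (hm : ∀ g₁ ∈ G₁, ∀ g₂ ∈ G₂, |f g₁ g₂| ≤ m) (s t : ℝ) :
    |f s t| ≤ m / (1 - n₂ * δ₂) / (1 - n₁ * δ₁) := by
  -- step 1: on every node of `G₁`, bound in the second variable
  have hnodes : ∀ g ∈ G₁, ∀ t, |f g t| ≤ m / (1 - n₂ * δ₂) := fun g hg t =>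
    abs_le_grid_div (hf₂ g hg) (hbdd₂ g hg) h₂ (hB₂ g hg) hG₂ (fun g₂ hg₂ => hm g hg g₂ hg₂) t
  -- step 2: at the fixed `t`, bound in the first variable
  exact abs_le_grid_div (hf₁ t) (hbdd₁ t) h₁ (hB₁ t) hG₁ (fun g hg => hnodes g hg t) s

end Literature.Analysis.ValidatedNumerics
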